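import Summits.KontsevichZagierPeriods.KontsevichZagierPeriods.Theorems.TerasomaMultiplicationBetaCancellationStubWeightConst
import Summits.KontsevichZagierPeriods.KontsevichZagierPeriods.Theorems.LiouvilleUnfoldingAyoubPiCancellationStubStripWeight
import Summits.KontsevichZagierPeriods.KontsevichZagierPeriods.Theorems.CompleteModGammaSector.Negative.ChangeOfVariables

/-!
# Crux stmt-KontsevichZagierPeriods-0540 (`LiouvilleUnfolding.AyoubPiCancellation` ≡ `KZ.PiCancellation`),
# line `Sketch` (idea `moving-segment-wronskian`): stub `stub_stripConst`

Support file (`--supports` stmt-KontsevichZagierPeriods-0540) of the line skeleton, registered stub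
`stub_stripConst` (M). The closed unit disc weighted by the STRIP WEIGHT of an interior strip
`-1 < a < b < 1` (`a b` rational), `D_w = [{x² + y² ≤ 1}, w_{a,b}(x)]`,
`w_{a,b}(t) = 𝟙_{(a,b)}(t) / (2√(1 − t²))`, is an integral representation of dimension `2` worth
the rational constant `b − a` against every factor `s = [σ, f]`: `s × D_w ∼ [σ, (b − a)·f]` in the
Kontsevich–Zagier calculus of `KZCalculus.lean`. Template: `BetaCancellationLine.stub_weightConst`
(`Theorems/TerasomaMultiplicationBetaCancellationStubWeightConst.lean`), with one extra cut:

* move 1 (Newton–Leibniz, printed rule (3), dimension `2 → 1`): `D_w ∼ K = [[-1, 1], 𝟙_{(a,b)}]`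
  (base `[-1, 1]`, edges `∓√(1 − x²)`, primitive `F (x, y) = y · w_{a,b}(x)`, boundary term
  `2√(1 − x²) · w_{a,b}(x) = 𝟙_{(a,b)}(x)`);
* the cut (domain additivity, printed rule (1), dimension `1`):
  `[-1, 1] = [a, b] ∪ ([-1, 1] ∖ [a, b])` and the kernel `𝟙_{(a,b)}` vanishes on the outer piece,
  so `K ∼ K_mid = [[a, b], 𝟙_{(a,b)}]`;
* move 2 (Newton–Leibniz, dimension `m + 1 → m`, over the arbitrary base `s = [σ, f]`):
  `s × K_mid ∼ [σ, (b − a)·f]`, constant edges `a ≤ b`, primitive `f ⊗ (x ↦ x)` (on the open fibre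
  `(a, b)` the kernel is `1`), boundary term `f · b − f · a = (b − a) · f`.

Move 1 and the cut are transported to the products with `s` by `KZ.Equivalent.prod`. No definitions:
the moves are stated for arbitrary representations with prescribed domains and integrands, which the
stub instantiates by anonymous constructors.
References: M. Kontsevich, D. Zagier, *Periods* (2001), §1.1 (eq. (1)), §1.2 (rules (1)–(3)).
-/

noncomputable section

-- `Summit.KontsevichZagierPeriods.KontsevichZagierPeriods.…` is the tree's mandated layout (single-conjunct summit).
set_option linter.dupNamespace false

namespace Summit.KontsevichZagierPeriods.KontsevichZagierPeriods.AyoubPiCancellationLine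

open Set MeasureTheory
open Literature.NumberTheory.Transcendental
open Literature.NumberTheory.Transcendental.KZ
open Literature.ModelTheory.ExponentialFields (IsSemialgebraic)
open MvPolynomial (aeval X C)
open Summit.KontsevichZagierPeriods.KontsevichZagierPeriods.BetaCancellationNegative
  (natAdd_zero_eq_last init_eq_comp_castAdd)
open Summit.KontsevichZagierPeriods.KontsevichZagierPeriods.BetaCancellationLine
  (weightConst_isSemialgebraic_seg weightConst_isCompact_seg weightConst_isSemialgebraicFunOn_edge
    weightConst_isCompact_piDisc prod_integrand_snoc)
open Summit.KontsevichZagierPeriods.CompleteModGammaSectorNegative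
  (isSemialgebraic_band isCompact_band)

-- adapted from Summits/KontsevichZagierPeriods/KontsevichZagierPeriods/Theorems/TerasomaMultiplicationBetaCancellationStubWeightConst.lean
-- (two Newton–Leibniz moves along the last coordinate, plus one domain-additivity cut)

/-- A function of `t ∈ ℝ` cut off to `(a, b)` and read on `ℝⁿ⁺¹` through the coordinate `x 0` is the
extension by zero off the slab `KZ.paramSlab n a b = {a < x 0 < b}`. [folklore] -/
theorem stripConst_indicator_apply {n : ℕ} (a b : ℚ) (g : ℝ → ℝ) (x : Fin (n + 1) → ℝ) :
    (Set.Ioo (a : ℝ) b).indicator g (x 0) = (paramSlab n a b).indicator (fun x => g (x 0)) x := by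
  by_cases hx : (a : ℝ) < x 0 ∧ x 0 < b
  · rw [indicator_of_mem (show x 0 ∈ Set.Ioo (a : ℝ) b from hx),
      indicator_of_mem (show x ∈ paramSlab n a b from hx)]
  · rw [indicator_of_notMem (show x 0 ∉ Set.Ioo (a : ℝ) b from hx),
      indicator_of_notMem (show x ∉ paramSlab n a b from hx)]

/-- The kernel `𝟙_{(a,b)}(x 0)` is `ℚ`-semialgebraic on every `ℚ`-semialgebraic subset of `ℝ¹`
(extension by zero of the constant `1` off a rational slab). [folklore] -/
theorem stripConst_isSemialgebraicFunOn_ker {s : Set (Fin 1 → ℝ)} (hs : IsSemialgebraic ℚ s)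
    (a b : ℚ) :
    IsSemialgebraicFunOn ℚ s (fun x => (Set.Ioo (a : ℝ) b).indicator (fun _ => (1 : ℝ)) (x 0)) := by
  have h1 : IsSemialgebraicFunOn ℚ (s ∩ paramSlab 0 a b) (fun _ => (1 : ℝ)) :=
    (isSemialgebraicFunOn_natCast (hs.inter (isSemialgebraic_paramSlab 0 a b)) 1).congr
      fun x _ => by simp
  exact (IsSemialgebraicFunOn.indicator hs (isSemialgebraic_paramSlab 0 a b) h1).congr
    fun x _ => (stripConst_indicator_apply a b (fun _ => (1 : ℝ)) x).symm

/-- The kernel `𝟙_{(a,b)}(x 0)` (measurable, bounded by `1`) is absolutely integrable on every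
subset of `ℝ¹` of finite measure. [folklore] -/
theorem stripConst_integrableOn_ker {s : Set (Fin 1 → ℝ)} (hs : volume s < ⊤) (a b : ℚ) :
    IntegrableOn (fun x : Fin 1 → ℝ => (Set.Ioo (a : ℝ) b).indicator (fun _ => (1 : ℝ)) (x 0)) s :=
  IntegrableOn.of_bound hs
    (((measurable_const (a := (1 : ℝ))).indicator measurableSet_Ioo).comp
      (measurable_pi_apply 0)).aestronglyMeasurable 1
    (Filter.Eventually.of_forall fun x => by
      rw [Real.norm_eq_abs]
      by_cases hx : x 0 ∈ Set.Ioo (a : ℝ) b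
      · rw [indicator_of_mem hx, abs_one]
      · rw [indicator_of_notMem hx, abs_zero]
        exact zero_le_one)

/-- For an interior strip, `[a, b] ⊆ [-1, 1]` in `ℝ¹`. [folklore] -/
theorem stripConst_mid_subset_seg {a b : ℚ} (ha : -1 < a) (hb : b < 1) :
    {x : Fin 1 → ℝ | (a : ℝ) ≤ x 0 ∧ x 0 ≤ b} ⊆ {x : Fin 1 → ℝ | -1 ≤ x 0 ∧ x 0 ≤ 1} := by
  rintro x ⟨h1, h2⟩
  have ha' : (-1 : ℝ) < (a : ℝ) := by exact_mod_cast ha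
  have hb' : ((b : ℚ) : ℝ) < 1 := by exact_mod_cast hb
  exact ⟨by linarith, by linarith⟩

/-- On the slab `KZ.paramSlab 1 a b = {a < z 0 < b} ⊆ ℝ²` of an interior strip the profile
`z ↦ 1 / (2√(1 - (z 0)²))` is `ℚ`-semialgebraic: a quotient of real semialgebraic functions with
non-vanishing denominator (Bochnak–Coste–Roy Prop. 2.2.6). [folklore] -/
theorem stripConst_isSemialgebraicFunOn_profile {a b : ℚ} (ha : -1 < a) (hb : b < 1) :
    IsSemialgebraicFunOn ℚ (paramSlab 1 a b)
      (fun z : Fin 2 → ℝ => 1 / (2 * Real.sqrt (1 - z 0 ^ 2))) := by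
  have hA : IsSemialgebraic ℚ (paramSlab 1 a b) := isSemialgebraic_paramSlab 1 a b
  have hnum : IsSemialgebraicFunOn ℚ (paramSlab 1 a b) (fun _ => (1 : ℝ)) :=
    (isSemialgebraicFunOn_natCast hA 1).congr fun x _ => by simp
  have hsqrt : IsSemialgebraicFunOn ℚ (paramSlab 1 a b) (fun z => Real.sqrt (1 - z 0 ^ 2)) :=
    (IsSemialgebraicFunOn.sqrt_holds (isSemialgebraicFunOn_aeval hA
      (1 - X 0 ^ 2 : MvPolynomial (Fin 2) ℚ))).congr fun x _ => by simp
  have hden : IsSemialgebraicFunOn ℚ (paramSlab 1 a b)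
      (fun z => 2 * Real.sqrt (1 - z 0 ^ 2)) :=
    (IsSemialgebraicFunOn.mul_holds (isSemialgebraicFunOn_natCast hA 2) hsqrt).congr
      fun x _ => by simp
  refine IsSemialgebraicFunOn.div hnum hden fun z hz => ?_
  rw [mem_paramSlab] at hz
  exact mul_ne_zero two_ne_zero
    (Real.sqrt_pos.mpr (stripWeight_radicand_pos ha hb hz.1 hz.2)).ne'

/-- The strip weight `(x, y) ↦ w_{a,b}(x)` is `ℚ`-semialgebraic on the closed unit disc (extension
by zero of a semialgebraic function off a semialgebraic set). [folklore] -/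
theorem stripConst_isSemialgebraicFunOn_weightDisc {a b : ℚ} (ha : -1 < a) (hb : b < 1) :
    IsSemialgebraicFunOn ℚ piDisc (fun z : Fin 2 → ℝ =>
      (Set.Ioo (a : ℝ) b).indicator (fun t => 1 / (2 * Real.sqrt (1 - t ^ 2))) (z 0)) := by
  have h : IsSemialgebraicFunOn ℚ piDisc
      ((paramSlab 1 a b).indicator (fun z => 1 / (2 * Real.sqrt (1 - z 0 ^ 2)))) :=
    IsSemialgebraicFunOn.indicator isSemialgebraic_piDisc (isSemialgebraic_paramSlab 1 a b)
      ((stripConst_isSemialgebraicFunOn_profile ha hb).mono inter_subset_right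
        (isSemialgebraic_piDisc.inter (isSemialgebraic_paramSlab 1 a b)))
  exact h.congr fun z _ =>
    (stripConst_indicator_apply a b (fun t => 1 / (2 * Real.sqrt (1 - t ^ 2))) z).symm

/-- The strip weight is absolutely integrable on the closed unit disc (measurable and bounded on a
set of finite measure). [folklore] -/
theorem stripConst_integrableOn_weight {a b : ℚ} (ha : -1 < a) (hab : a < b) (hb : b < 1) :
    IntegrableOn (fun z : Fin 2 → ℝ =>
      (Set.Ioo (a : ℝ) b).indicator (fun t => 1 / (2 * Real.sqrt (1 - t ^ 2))) (z 0)) piDisc := by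
  have hg : Measurable (fun t : ℝ => 1 / (2 * Real.sqrt (1 - t ^ 2))) := by fun_prop
  exact IntegrableOn.of_bound weightConst_isCompact_piDisc.measure_lt_top
    ((hg.indicator measurableSet_Ioo).comp (measurable_pi_apply 0)).aestronglyMeasurable _
    (Filter.Eventually.of_forall fun z => by
      rw [Real.norm_eq_abs]
      exact stripWeight_abs_le ha hab hb (z 0))

/-- **`D_w − [[-1, 1], 𝟙_{(a,b)}(x)]` is one Newton–Leibniz move** (for any representations `D`,
`K` with these domains and integrands): base `[-1, 1]`, edges `-√(1 - x²) ≤ √(1 - x²)`, primitive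
`F (x, y) = y · w_{a,b}(x)` (`∂F/∂y = w_{a,b}(x)`,
`F (x, √(1 - x²)) - F (x, -√(1 - x²)) = 2√(1 - x²) · w_{a,b}(x) = 𝟙_{(a,b)}(x)`).
[cite: KontsevichZagier2001, §1.2 rule (3)] -/
theorem stripConst_of_sub_of_mem_newtonLeibnizRel_of_disc {a b : ℚ} (ha : -1 < a) (hb : b < 1)
    (D : IntegralRep 2) (K : IntegralRep 1) (hDd : D.domain = piDisc)
    (hDi : D.integrand = fun z =>
      (Set.Ioo (a : ℝ) b).indicator (fun t => 1 / (2 * Real.sqrt (1 - t ^ 2))) (z 0))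
    (hKd : K.domain = {x : Fin 1 → ℝ | -1 ≤ x 0 ∧ x 0 ≤ 1})
    (hKi : K.integrand = fun x => (Set.Ioo (a : ℝ) b).indicator (fun _ => (1 : ℝ)) (x 0)) :
    of D - of K ∈ newtonLeibnizRel := by
  refine ⟨1, D, K, fun x => -Real.sqrt (1 - x 0 ^ 2), fun x => Real.sqrt (1 - x 0 ^ 2),
    fun z => z (Fin.last 1) *
      (Set.Ioo (a : ℝ) b).indicator (fun t => 1 / (2 * Real.sqrt (1 - t ^ 2))) (z 0),
    ?_, ?_, ?_, ?_, ?_, ?_, ?_, ?_, rfl⟩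
  · -- `F (x, y) = y · w (x)` (a coordinate times the weight) is semialgebraic on the disc
    rw [hDd]
    exact (IsSemialgebraicFunOn.mul_holds (isSemialgebraicFunOn_aeval isSemialgebraic_piDisc
      (X (Fin.last 1) : MvPolynomial (Fin 2) ℚ))
      (stripConst_isSemialgebraicFunOn_weightDisc ha hb)).congr fun z _ => by simp
  · -- the lower edge
    rw [hKd]
    exact weightConst_isSemialgebraicFunOn_edge.neg
  · -- the upper edge
    rw [hKd]
    exact weightConst_isSemialgebraicFunOn_edge
  · -- `-√ ≤ √` on the base
    intro x _
    have hu := Real.sqrt_nonneg (1 - x 0 ^ 2)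
    linarith
  · -- the disc is the band `{-√(1 - x²) ≤ y ≤ √(1 - x²)}` over the base segment
    rw [hDd, hKd]
    ext z
    have e0 : Fin.init z 0 = z 0 := rfl
    have e1 : z (Fin.last 1) = z 1 := rfl
    simp only [mem_piDisc, mem_setOf_eq, e0, e1]
    constructor
    · intro h
      have h0 : z 0 ^ 2 ≤ 1 ^ 2 := by nlinarith [sq_nonneg (z 1)]
      have hnn : 0 ≤ 1 - z 0 ^ 2 := by nlinarith [sq_nonneg (z 1)]
      have h4 : z 1 ^ 2 ≤ Real.sqrt (1 - z 0 ^ 2) ^ 2 := by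
        rw [Real.sq_sqrt hnn]
        linarith
      exact ⟨abs_le_of_sq_le_sq' h0 zero_le_one, abs_le_of_sq_le_sq' h4 (Real.sqrt_nonneg _)⟩
    · rintro ⟨⟨h1, h2⟩, h3, h4⟩
      have hnn : 0 ≤ 1 - z 0 ^ 2 := by nlinarith
      have h5 := sq_le_sq' h3 h4
      rw [Real.sq_sqrt hnn] at h5
      linarith
  · -- continuity of `y ↦ F (x, y) = y · w (x)` on the closed fibre
    intro x _
    simp only [Fin.snoc_last, Fin.snoc_apply_zero]
    fun_prop
  · -- `∂F/∂y = w (x)` is the integrand of `D_w`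
    intro x _ t _
    have h : HasDerivAt (fun s : ℝ => s *
        (Set.Ioo (a : ℝ) b).indicator (fun t => 1 / (2 * Real.sqrt (1 - t ^ 2))) (x 0))
        (1 * (Set.Ioo (a : ℝ) b).indicator (fun t => 1 / (2 * Real.sqrt (1 - t ^ 2))) (x 0)) t :=
      (hasDerivAt_id' t).mul_const _
    rw [one_mul] at h
    simpa only [Fin.snoc_last, Fin.snoc_apply_zero, hDi] using h
  · -- the boundary term is the kernel: `2√(1 - x²) · w_{a,b}(x) = 𝟙_{(a,b)}(x)`
    intro x _
    simp only [Fin.snoc_last, Fin.snoc_apply_zero, hKi]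
    by_cases h0 : x 0 ∈ Set.Ioo (a : ℝ) b
    · rw [indicator_of_mem h0, indicator_of_mem h0]
      have hs : 0 < Real.sqrt (1 - x 0 ^ 2) :=
        Real.sqrt_pos.mpr (stripWeight_radicand_pos ha hb h0.1 h0.2)
      field_simp
      ring
    · rw [indicator_of_notMem h0, indicator_of_notMem h0]
      ring

/-- **The cut at `x = a, b`** (for any representations `K`, `K_mid`, `K_out` with these domains and
the kernel `𝟙_{(a,b)}(x)` as integrand): `[-1, 1] = [a, b] ∪ ([-1, 1] ∖ [a, b])` with empty
intersection is one domain-additivity move `[K] − [K_mid] − [K_out]`, and `[K_out]` is a relation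
since the kernel vanishes on the outer piece; hence `K ∼ K_mid`. [folklore] -/
theorem stripConst_of_sub_of_mem_relations_of_cut {a b : ℚ} (ha : -1 < a) (hb : b < 1)
    (K Kmid Kout : IntegralRep 1)
    (hKd : K.domain = {x : Fin 1 → ℝ | -1 ≤ x 0 ∧ x 0 ≤ 1})
    (hKi : K.integrand = fun x => (Set.Ioo (a : ℝ) b).indicator (fun _ => (1 : ℝ)) (x 0))
    (hMd : Kmid.domain = {x : Fin 1 → ℝ | (a : ℝ) ≤ x 0 ∧ x 0 ≤ b})
    (hMi : Kmid.integrand = fun x => (Set.Ioo (a : ℝ) b).indicator (fun _ => (1 : ℝ)) (x 0))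
    (hOd : Kout.domain =
      {x : Fin 1 → ℝ | -1 ≤ x 0 ∧ x 0 ≤ 1} \ {x : Fin 1 → ℝ | (a : ℝ) ≤ x 0 ∧ x 0 ≤ b})
    (hOi : Kout.integrand = fun x => (Set.Ioo (a : ℝ) b).indicator (fun _ => (1 : ℝ)) (x 0)) :
    of K - of Kmid ∈ relations := by
  have h1 : of K - of Kmid - of Kout ∈ relations := by
    refine domainAddRel_subset_relations ⟨1, K, Kmid, Kout, ?_, ?_, ?_, ?_, rfl⟩
    · rw [hKd, hMd, hOd, union_sdiff_cancel (stripConst_mid_subset_seg ha hb)]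
    · rw [hMd, hOd, inter_sdiff_self, measure_empty]
    · intro x _
      rw [hKi, hMi]
    · intro x _
      rw [hKi, hOi]
  have h2 : of Kout ∈ relations := by
    refine of_mem_relations_of_eqOn_zero Kout fun x hx => ?_
    rw [hOd, mem_sdiff, mem_setOf_eq, mem_setOf_eq] at hx
    have hx0 : x 0 ∉ Set.Ioo (a : ℝ) b := fun h => hx.2 ⟨h.1.le, h.2.le⟩
    simp [hOi, indicator_of_notMem hx0]
  have : of K - of Kmid = (of K - of Kmid - of Kout) + of Kout := by abel
  rw [this]
  exact relations.add_mem h1 h2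

/-- **`s × [[a, b], 𝟙_{(a,b)}] − [σ, (b − a)·f]` is one Newton–Leibniz move** over the arbitrary
base `s = [σ, f]` (for any representations `K_mid = [[a, b], 𝟙_{(a,b)}]`, `P = [[a, b], x]` with
these domains and integrands): constant edges `a ≤ b`, primitive `F = f ⊗ (x ↦ x)`, whose fibre
derivative `f` is the integrand `f · 𝟙_{(a,b)} = f` on the open fibre `(a, b)`; boundary term
`f · b − f · a = (b − a) · f`. [cite: KontsevichZagier2001, §1.2 rule (3)] -/
theorem stripConst_of_prod_sub_of_constMul_mem_newtonLeibnizRel {a b : ℚ} (hab : a < b) {m : ℕ}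
    (s : IntegralRep m) (Kmid P : IntegralRep 1)
    (hMd : Kmid.domain = {x : Fin 1 → ℝ | (a : ℝ) ≤ x 0 ∧ x 0 ≤ b})
    (hMi : Kmid.integrand = fun x => (Set.Ioo (a : ℝ) b).indicator (fun _ => (1 : ℝ)) (x 0))
    (hPd : P.domain = {x : Fin 1 → ℝ | (a : ℝ) ≤ x 0 ∧ x 0 ≤ b})
    (hPi : P.integrand = fun x => x 0) (hκ : IsAlgebraic ℚ ((b - a : ℚ) : ℝ)) :
    of (s.prod Kmid) - of (s.constMul ((b - a : ℚ) : ℝ) hκ) ∈ newtonLeibnizRel := by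
  have hdom : (s.prod Kmid).domain = (s.prod P).domain := by
    ext z
    simp only [IntegralRep.prod_domain, IntegralRep.mem_prodDomain, hMd, hPd]
  have hab' : (a : ℝ) ≤ b := by exact_mod_cast hab.le
  refine ⟨m, s.prod Kmid, s.constMul ((b - a : ℚ) : ℝ) hκ, fun _ => (a : ℝ), fun _ => (b : ℝ),
    (s.prod P).integrand, ?_, ?_, ?_, fun _ _ => hab', ?_, ?_, ?_, ?_, rfl⟩
  · -- `F = f ⊗ x` is the integrand of a product representation, hence semialgebraic
    rw [hdom]
    exact (s.prod P).isSemialgebraicFunOn_integrand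
  · -- the edge `a` is semialgebraic on `σ`
    exact (isSemialgebraicFunOn_aeval s.isSemialgebraic_domain
      (C a : MvPolynomial (Fin m) ℚ)).congr fun x _ => by simp
  · -- the edge `b` is semialgebraic on `σ`
    exact (isSemialgebraicFunOn_aeval s.isSemialgebraic_domain
      (C b : MvPolynomial (Fin m) ℚ)).congr fun x _ => by simp
  · -- `σ × [a, b]` is the band with constant edges over `σ`
    ext z
    simp only [IntegralRep.prod_domain, IntegralRep.mem_prodDomain, hMd,
      IntegralRep.domain_constMul, mem_setOf_eq, init_eq_comp_castAdd, natAdd_zero_eq_last]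
  · -- continuity of `t ↦ f x · t` on the closed fibre
    intro x _
    simp only [prod_integrand_snoc, hPi]
    fun_prop
  · -- `∂/∂t (f x · t) = f x = f x · 𝟙_{(a,b)}(t)` on the open fibre
    intro x _ t ht
    have ht' : t ∈ Set.Ioo (a : ℝ) b := ht
    have hF : (fun t : ℝ => (s.prod P).integrand (Fin.snoc x t)) =
        fun t => s.integrand x * t := by
      funext t
      simp only [prod_integrand_snoc, hPi]
    have hk : (s.prod Kmid).integrand (Fin.snoc x t) = s.integrand x * 1 := by
      simp only [prod_integrand_snoc, hMi, indicator_of_mem ht']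
    rw [hF, hk]
    exact (hasDerivAt_id' t).const_mul (s.integrand x)
  · -- the boundary term: `(b - a) f x = f x · b - f x · a`
    intro x _
    simp only [prod_integrand_snoc, hPi, IntegralRep.integrand_constMul]
    push_cast
    ring

/-- **STUB `stub_stripConst`** (M) of the line `Sketch`: the strip-weighted closed unit disc
`D_w = [{x² + y² ≤ 1}, w_{a,b}(x)]`, `w_{a,b}(x) = 𝟙_{(a,b)}(x) / (2√(1 − x²))`, of an interior
strip `-1 < a < b < 1` is a representation worth the rational constant `b − a` against every factor:
`s × D_w ∼ [σ, (b − a)·f]` for every `s = [σ, f]` (`∫ w_{a,b} dy = 𝟙_{(a,b)}(x)` over the fibres of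
the disc, cut at `x = a, b`, `∫_a^b dx = b − a`). [folklore] -/
theorem stub_stripConst : ∀ (a b : ℚ), -1 < a → a < b → b < 1 →
    ∃ Dw : IntegralRep 2, Dw.domain = piDisc ∧
      (Dw.integrand = fun z =>
        (Set.Ioo (a : ℝ) b).indicator (fun t => 1 / (2 * Real.sqrt (1 - t ^ 2))) (z 0)) ∧
      ∀ (hκ : IsAlgebraic ℚ ((b - a : ℚ) : ℝ)) (m : ℕ) (s : IntegralRep m),
        Equivalent (s.prod Dw) (s.constMul ((b - a : ℚ) : ℝ) hκ) := by
  intro a b ha hab hb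
  let Dw : IntegralRep 2 :=
    ⟨piDisc,
      fun z => (Set.Ioo (a : ℝ) b).indicator (fun t => 1 / (2 * Real.sqrt (1 - t ^ 2))) (z 0),
      isSemialgebraic_piDisc, stripConst_isSemialgebraicFunOn_weightDisc ha hb,
      stripConst_integrableOn_weight ha hab hb⟩
  let K : IntegralRep 1 :=
    ⟨{x : Fin 1 → ℝ | -1 ≤ x 0 ∧ x 0 ≤ 1},
      fun x => (Set.Ioo (a : ℝ) b).indicator (fun _ => (1 : ℝ)) (x 0),
      weightConst_isSemialgebraic_seg,
      stripConst_isSemialgebraicFunOn_ker weightConst_isSemialgebraic_seg a b,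
      stripConst_integrableOn_ker weightConst_isCompact_seg.measure_lt_top a b⟩
  let Kmid : IntegralRep 1 :=
    ⟨{x : Fin 1 → ℝ | (a : ℝ) ≤ x 0 ∧ x 0 ≤ b},
      fun x => (Set.Ioo (a : ℝ) b).indicator (fun _ => (1 : ℝ)) (x 0),
      isSemialgebraic_band a b,
      stripConst_isSemialgebraicFunOn_ker (isSemialgebraic_band a b) a b,
      stripConst_integrableOn_ker (isCompact_band (a : ℝ) b).measure_lt_top a b⟩
  let Kout : IntegralRep 1 :=
    ⟨{x : Fin 1 → ℝ | -1 ≤ x 0 ∧ x 0 ≤ 1} \ {x : Fin 1 → ℝ | (a : ℝ) ≤ x 0 ∧ x 0 ≤ b},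
      fun x => (Set.Ioo (a : ℝ) b).indicator (fun _ => (1 : ℝ)) (x 0),
      weightConst_isSemialgebraic_seg.diff (isSemialgebraic_band a b),
      stripConst_isSemialgebraicFunOn_ker
        (weightConst_isSemialgebraic_seg.diff (isSemialgebraic_band a b)) a b,
      stripConst_integrableOn_ker
        ((measure_mono Set.sdiff_subset).trans_lt weightConst_isCompact_seg.measure_lt_top) a b⟩
  let P : IntegralRep 1 :=
    ⟨{x : Fin 1 → ℝ | (a : ℝ) ≤ x 0 ∧ x 0 ≤ b}, fun x => x 0, isSemialgebraic_band a b,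
      (isSemialgebraicFunOn_aeval (isSemialgebraic_band a b)
        (X 0 : MvPolynomial (Fin 1) ℚ)).congr fun x _ => by simp,
      (Continuous.continuousOn (by fun_prop)).integrableOn_compact (isCompact_band (a : ℝ) b)⟩
  refine ⟨Dw, rfl, rfl, fun hκ m s => ?_⟩
  have h1 : Equivalent Dw K := newtonLeibnizRel_subset_relations
    (stripConst_of_sub_of_mem_newtonLeibnizRel_of_disc ha hb Dw K rfl rfl rfl rfl)
  have h2 : Equivalent K Kmid :=
    stripConst_of_sub_of_mem_relations_of_cut ha hb K Kmid Kout rfl rfl rfl rfl rfl rfl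
  have h3 : Equivalent (s.prod Kmid) (s.constMul ((b - a : ℚ) : ℝ) hκ) :=
    newtonLeibnizRel_subset_relations
      (stripConst_of_prod_sub_of_constMul_mem_newtonLeibnizRel hab s Kmid P rfl rfl rfl rfl hκ)
  exact (Equivalent.prod (Equivalent.refl s) (h1.trans h2)).trans h3

end Summit.KontsevichZagierPeriods.KontsevichZagierPeriods.AyoubPiCancellationLine
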